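import Summits.NavierStokesRegularity.NavierStokesRegularity.Theses.QuantisedSymmetry
import Summits.NavierStokesRegularity.NavierStokesRegularity.Theses.Blowup
import Summits.NavierStokesRegularity.NavierStokesRegularity.Theses.DssFarFieldSlaving
import Summits.NavierStokesRegularity.NavierStokesRegularity.Theorems.QuantisedSymmetryPolyhedralTruncationBridge
import Summits.NavierStokesRegularity.NavierStokesRegularity.Theorems.QuantisedSymmetryPolyhedralDssProfileExistsOfCell
import Summits.NavierStokesRegularity.NavierStokesRegularity.Theorems.QuantisedSymmetryPolyhedralDssProfileExistsDominatesBlowupProfile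
import Summits.NavierStokesRegularity.NavierStokesRegularity.Theorems.QuantisedSymmetryLiouvilleKillsProfile
import Summits.NavierStokesRegularity.NavierStokesRegularity.Theorems.DssFarFieldSlavingDssTruncationBridge
import Summits.NavierStokesRegularity.NavierStokesRegularity.Theorems.PumpContinuationEulerProximatePumpTruncationBridgeTypeI
import Literature.Analysis.FluidPDE.HyperbolicDSSOrbit
import Literature.Analysis.FluidPDE.ChaeWolfExistenceHolds
import Literature.Analysis.FluidPDE.PineauVicolRDSSLiouvilleHolds
import HarnessLib

/-!
# Strategist sketch S14-g2 (second INDEPENDENT strategy census, family `s`, gen 2) for the crux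
  `QuantisedSymmetry.PolyhedralDssProfileExists` (stmt-NavierStokesRegularity-1404)

Typed signatures backing `Cruxes/PolyhedralDssProfileExists/STRATEGY-CENSUS-s14.md`:

* §0 `crux_decides`, `crux_decides'` — the crux ALONE refutes the summit through two LANDED chains
  (route `QuantisedSymmetry`: bridge stmt-11331 + Clay uniqueness stmt-0153 proved; route
  `DssFarFieldSlaving`: `stub_dominatesBlowupProfile` + `dssTruncationBridge_proof`).
* §1 weaker intermediates `W⋆ ⊇ X⁻`, `W1` (= stmt-0155), `W2` (Type-I blow-up), `W3` (= X5a of route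
  `Blowup`): the chain `X⁻ → W⋆ → W1 → W2 → W3 → ¬NavierStokesRegularity` is proved here from tree
  theorems — every rung still decides the summit.
* §2 strengthening `S⁺` (hyperbolic polyhedral orbit, accepted `IsHyperbolicTypeIDSSOrbit`) with
  `crux_of_sPlus`.
* §3 the CAP split `D1a_Candidate δ η ∧ D1b_Closing δ η → X⁻` (assembly `crux_of_D1` proved via the
  registered reduction `stub_profileOfPolyhedralCell`).
* §4 transfer: the forward engine (`chaeWolf2018_dss_existence_holds`) is a tree theorem; its
  a-priori bound is the step that does not transfer backward (see the census).
* §5 negation: the kill switch stmt-1405 and the in-tree near-`λ = 1` Liouville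
  (`pineauVicol2026_rdss_liouville_holds`).

Nothing here is a route item, a stub of the lead's skeleton, or a change to `closes`.
-/

set_option linter.dupNamespace false
set_option linter.unusedVariables false

noncomputable section

namespace Summit.NavierStokesRegularity.NavierStokesRegularity.Cruxes.PolyhedralDssProfileExists.S14g2

open MeasureTheory Set Filter
open Literature.Analysis.FluidPDE
open Summit.NavierStokesRegularity.NavierStokesRegularity

/-- `ℝ³` as used by the route. -/
abbrev E3 : Type := EuclideanSpace ℝ (Fin 3)

/-- The crux, by name. -/
abbrev Crux : Prop := Theses.QuantisedSymmetry.PolyhedralDssProfileExists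

/-- Finite irreducible proper rotation group (the three group clauses of X⁻). -/
def IsPolyhedralGroup (G : Subgroup (E3 ≃ₗᵢ[ℝ] E3)) : Prop :=
  Finite G ∧ (∀ g ∈ G, LinearMap.det (g.toLinearEquiv : E3 →ₗ[ℝ] E3) = 1) ∧
    (∀ V : Submodule ℝ E3, (∀ g ∈ G, ∀ v ∈ V, g v ∈ V) → V = ⊥ ∨ V = ⊤)

/-- The analytic body of X⁻: a nontrivial `G`-equivariant Type-I `c`-DSS ancient mild solution. -/
def IsSymmetricTypeIDssProfile (G : Subgroup (E3 ≃ₗᵢ[ℝ] E3)) (c : ℝ) (u : ℝ → E3 → E3) : Prop :=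
  IsAncientMildSolution 1 u ∧ (∀ t < 0, AEStronglyMeasurable (u t) volume) ∧
    IsDiscretelySelfSimilar c u ∧ (∃ C₀ : ℝ, HasTypeIDecay C₀ u) ∧
    (∀ g ∈ G, ∀ t x, u t (g x) = g (u t x)) ∧ ¬ (∀ t < 0, u t =ᵐ[volume] 0)

theorem crux_iff :
    Crux ↔ ∃ G, IsPolyhedralGroup G ∧ ∃ c : ℝ, 1 < c ∧ ∃ u, IsSymmetricTypeIDssProfile G c u := by
  constructor
  · rintro ⟨G, hfin, hdet, hirr, c, hc, u, h1, h2, h3, h4, h5, h6⟩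
    exact ⟨G, ⟨hfin, hdet, hirr⟩, c, hc, u, h1, h2, h3, h4, h5, h6⟩
  · rintro ⟨G, ⟨hfin, hdet, hirr⟩, c, hc, u, h1, h2, h3, h4, h5, h6⟩
    exact ⟨G, hfin, hdet, hirr, c, hc, u, h1, h2, h3, h4, h5, h6⟩

/-! ## §0 The crux alone decides the summit (landed chains) -/

/-- Chain 1: route `QuantisedSymmetry`'s own deciding theorem with its two other binders PROVED. -/
theorem crux_decides (hX : Crux) : ¬ _root_.NavierStokesRegularity :=
  Theses.QuantisedSymmetry.closes hX Theorems.quantisedSymmetry_polyhedralTruncationBridge_proof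
    Theses.QuantisedSymmetry.ClayUniqueness_holds

/-- Chain 2: through stmt-0155 and route `DssFarFieldSlaving` (bridge proved). -/
theorem crux_decides' (hX : Crux) : ¬ _root_.NavierStokesRegularity :=
  Theses.DssFarFieldSlaving.closes Theorems.dssTruncationBridge_proof
    (Theorems.PolyhedralDssProfileExists.PolyhedralCell.stub_dominatesBlowupProfile hX)

/-! ## §1 Weaker intermediates — each still decides the summit -/

/-- No nonzero `G`-fixed vector: the representation-theoretic LEVER of the route (kills the
translation and — via `so(3) ≅ ℝ³` — the rotation neutral Floquet modes). -/
def HasNoFixedVector (G : Subgroup (E3 ≃ₗᵢ[ℝ] E3)) : Prop :=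
  ∀ v : E3, (∀ g ∈ G, g v = v) → v = 0

/-- Irreducibility on `ℝ³` already gives the lever (a fixed line would be invariant; if everything
is fixed, any line is invariant and proper). -/
theorem hasNoFixedVector_of_irreducible {G : Subgroup (E3 ≃ₗᵢ[ℝ] E3)}
    (hirr : ∀ V : Submodule ℝ E3, (∀ g ∈ G, ∀ v ∈ V, g v ∈ V) → V = ⊥ ∨ V = ⊤) :
    HasNoFixedVector G := by
  intro v hv
  by_contra hv0
  have hL : ∀ g ∈ G, ∀ w ∈ (ℝ ∙ v), g w ∈ (ℝ ∙ v) := by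
    intro g hg w hw
    obtain ⟨a, rfl⟩ := Submodule.mem_span_singleton.mp hw
    rw [map_smul, hv g hg]
    exact Submodule.mem_span_singleton.mpr ⟨a, rfl⟩
  rcases hirr (ℝ ∙ v) hL with h | h
  · exact hv0 ((Submodule.span_singleton_eq_bot).mp h)
  · have h1 : Module.finrank ℝ (ℝ ∙ v) = 1 := finrank_span_singleton hv0
    rw [h, finrank_top, finrank_euclideanSpace_fin] at h1
    omega

/-- **W⋆ (keeps the lever, drops irreducibility):** a nontrivial Type-I DSS ancient mild profile
equivariant under a finite proper rotation group WITHOUT FIXED VECTOR (dihedral `Dₙ`, `n ≥ 2`, now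
allowed besides `T/O/I`). -/
def WStar_FixedPointFreeSector : Prop :=
  ∃ G : Subgroup (E3 ≃ₗᵢ[ℝ] E3), Finite G ∧
    (∀ g ∈ G, LinearMap.det (g.toLinearEquiv : E3 →ₗ[ℝ] E3) = 1) ∧ HasNoFixedVector G ∧
    ∃ c : ℝ, 1 < c ∧ ∃ u, IsSymmetricTypeIDssProfile G c u

theorem wstar_of_crux : Crux → WStar_FixedPointFreeSector := by
  rintro ⟨G, hfin, hdet, hirr, c, hc, u, h1, h2, h3, h4, h5, h6⟩
  exact ⟨G, hfin, hdet, hasNoFixedVector_of_irreducible hirr, c, hc, u, h1, h2, h3, h4, h5, h6⟩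

/-- **W1 (drop the symmetry altogether)** = stmt-0155, the deciding crux of routes `Blowup` /
`DssFarFieldSlaving`. -/
abbrev W1_NoSymmetry : Prop := Theses.Blowup.BlowupTypeIDssProfile

theorem w1_of_wstar : WStar_FixedPointFreeSector → W1_NoSymmetry := by
  rintro ⟨G, -, -, -, c, hc, u, hanc, hmeas, hdss, hdec, -, hnt⟩
  dsimp only [W1_NoSymmetry, Theses.Blowup.BlowupTypeIDssProfile]
  exact fun hL => hnt ((hL c).1 hc u hanc hmeas hdss hdec)

theorem w1_of_crux : Crux → W1_NoSymmetry :=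
  Theorems.PolyhedralDssProfileExists.PolyhedralCell.stub_dominatesBlowupProfile

/-- **W2 (a Type-I blow-up from a rapidly decaying datum).** -/
def W2_TypeIBlowup : Prop :=
  ∃ ν : ℝ, 0 < ν ∧ ∃ T : ℝ, 0 < T ∧ ∃ (u : ℝ → E3 → E3) (p : ℝ → E3 → ℝ),
    IsMaximalSmoothSolution ν 0 u p T ∧ IsLerayHopfOn T ν 0 (u 0) u ∧
      HasRapidSpatialDecay (u 0) ∧ IsTypeIBlowup u T

theorem w2_of_w1 : W1_NoSymmetry → W2_TypeIBlowup := fun h =>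
  Theorems.dssTruncationBridgeTypeI_proof h

/-- **W3 (finite-time blow-up, X5a of route `Blowup`).** -/
abbrev W3_Blowup : Prop := Theses.Blowup.BlowupExists

theorem w3_of_w2 : W2_TypeIBlowup → W3_Blowup := by
  rintro ⟨ν, hν, T, hT, u, p, hmax, hLH, hdec, -⟩
  exact ⟨ν, hν, T, hT, u, p, hmax, hLH, hdec⟩

theorem w1_decides : W1_NoSymmetry → ¬ _root_.NavierStokesRegularity := fun h =>
  Theses.DssFarFieldSlaving.closes Theorems.dssTruncationBridge_proof h

theorem w3_decides : W3_Blowup → ¬ _root_.NavierStokesRegularity := fun h =>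
  Theses.Blowup.closes h Theses.Blowup.BlowupClayUniqueness_holds

/-- The whole ladder of weaker intermediates decides the summit: nothing on it is "short of S". -/
theorem ladder_decides :
    (Crux → WStar_FixedPointFreeSector) ∧ (WStar_FixedPointFreeSector → W1_NoSymmetry) ∧
      (W1_NoSymmetry → W2_TypeIBlowup) ∧ (W2_TypeIBlowup → W3_Blowup) ∧
      (W3_Blowup → ¬ _root_.NavierStokesRegularity) :=
  ⟨wstar_of_crux, w1_of_wstar, w2_of_w1, w3_of_w2, w3_decides⟩

/-! ## §2 Strengthening -/

/-- **S⁺ (hyperbolic polyhedral orbit):** a polyhedral profile whose Leray orbit is HYPERBOLIC in the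
Gaussian solenoidal space (accepted `IsHyperbolicTypeIDSSOrbit` at the trivial rotation: compact
linearised monodromy, neutral multipliers exactly the symmetry modes). In the `G`-sector the
symmetry modes other than the orbit tangent are absent (`HasNoFixedVector` on translations and on
`so(3) ≅ ℝ³`). -/
def SPlus_HyperbolicPolyhedralProfile : Prop :=
  ∃ G, IsPolyhedralGroup G ∧ ∃ (c : ℝ) (u : ℝ → E3 → E3),
    IsHyperbolicTypeIDSSOrbit c (LinearIsometryEquiv.refl ℝ E3) u ∧
      (∀ g ∈ G, ∀ t x, u t (g x) = g (u t x))

theorem crux_of_sPlus : SPlus_HyperbolicPolyhedralProfile → Crux := by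
  rintro ⟨G, ⟨hfin, hdet, hirr⟩, c, u, hH, heqv⟩
  have hH' : IsHyperbolicTypeIDSSOrbitW gaussianWeight c (LinearIsometryEquiv.refl ℝ E3) u := hH
  have hP : IsTypeIDSSProfile c (LinearIsometryEquiv.refl ℝ E3) u := hH'.toIsTypeIDSSProfile
  exact ⟨G, hfin, hdet, hirr, c, hP.one_lt, u, hP.isAncientMildSolution, hP.aestronglyMeasurable,
    isRotatedDSS_refl_iff.mp hP.isRotatedDSS, hP.hasTypeIDecay, heqv, hP.nontrivial⟩

/-! ## §3 Decomposition: the CAP (candidate + closing) split of the cell -/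

/-- The OPEN clauses of a `G`-cell on the model window `[-1, -c⁻²]` (everything in the registered
stub `stub_polyhedralCellExists` except the closing condition): joint continuity, boundedness,
weak divergence-freeness, Oseen-mildness between model times, slice-wise `G`-equivariance. -/
def CellCore (G : Subgroup (E3 ≃ₗᵢ[ℝ] E3)) (c : ℝ) (v : ℝ → E3 → E3) : Prop :=
  ContinuousOn (Function.uncurry v) (Set.Icc (-1 : ℝ) (-(c ^ 2)⁻¹) ×ˢ Set.univ) ∧
    (∃ M : ℝ, ∀ t ∈ Set.Icc (-1 : ℝ) (-(c ^ 2)⁻¹), ∀ x, ‖v t x‖ ≤ M) ∧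
    (∀ t ∈ Set.Icc (-1 : ℝ) (-(c ^ 2)⁻¹), IsWeaklyDivFree (v t)) ∧
    (∀ s t : ℝ, -1 ≤ s → s < t → t ≤ -(c ^ 2)⁻¹ → ∀ x,
      v t x = heatFlow (v s) (t - s) x - oseenDuhamel 1 s v v t x) ∧
    (∀ g ∈ G, ∀ t ∈ Set.Icc (-1 : ℝ) (-(c ^ 2)⁻¹), ∀ x, v t (g x) = g (v t x))

/-- Closing defect at most `δ` in sup norm: `‖v(-c⁻², x) − c v(-1, c x)‖ ≤ δ`. -/
def ClosingDefectLE (c δ : ℝ) (v : ℝ → E3 → E3) : Prop :=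
  ∀ x, ‖v (-(c ^ 2)⁻¹) x - c • v (-1) (c • x)‖ ≤ δ

/-- **D1a (numerical candidate):** an approximate polyhedral cell with closing defect `≤ δ`, `L⁴`
datum, and a bump of size `η` somewhere. -/
def D1a_Candidate (δ η : ℝ) : Prop :=
  ∃ G, IsPolyhedralGroup G ∧ ∃ c : ℝ, 1 < c ∧ ∃ v : ℝ → E3 → E3,
    CellCore G c v ∧ ClosingDefectLE c δ v ∧ MemLp (v (-1)) 4 volume ∧ ∃ x, η ≤ ‖v (-1) x‖

/-- **D1b (closing lemma at tolerance `δ`, amplitude `η`):** every such approximate cell has an exact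
nontrivial cell in the same sector with the same factor. A Newton–Kantorovich theorem proves this
ONLY under a certificate `‖(I − D𝓡_G(v̄))⁻¹‖ ≤ K`, `K·δ` small — a hypothesis about the Fréchet
derivative of the renormalisation map that the tree cannot yet state; as typed (uniform in `v̄`)
it is the place where the whole crux re-enters. -/
def D1b_Closing (δ η : ℝ) : Prop :=
  ∀ G, IsPolyhedralGroup G → ∀ c : ℝ, 1 < c → ∀ v : ℝ → E3 → E3,
    CellCore G c v → ClosingDefectLE c δ v → MemLp (v (-1)) 4 volume → (∃ x, η ≤ ‖v (-1) x‖) →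
      ∃ w : ℝ → E3 → E3, CellCore G c w ∧ ClosingDefectLE c 0 w ∧ MemLp (w (-1)) 4 volume ∧
        ¬ (w (-1) =ᵐ[volume] 0)

/-- ASSEMBLY of the split (proved): candidate + closing ⇒ an exact polyhedral cell ⇒ X⁻ by the
registered reduction `stub_profileOfPolyhedralCell`. -/
theorem crux_of_D1 {δ η : ℝ} : D1a_Candidate δ η → D1b_Closing δ η → Crux := by
  rintro ⟨G, hG, c, hc, v, hcore, hdef, hL4, hbump⟩ hB
  obtain ⟨w, hw, hw0, hwL4, hwnt⟩ := hB G hG c hc v hcore hdef hL4 hbump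
  obtain ⟨hfin, hdet, hirr⟩ := hG
  obtain ⟨hcont, hbd, hdiv, hmild, heqv⟩ := hw
  apply Theorems.PolyhedralDssProfileExists.PolyhedralCell.stub_profileOfPolyhedralCell
  refine ⟨G, hfin, hdet, hirr, c, hc, w, ⟨hcont, hbd, hdiv, hmild, ?_, heqv⟩, hwL4, hwnt⟩
  intro x
  have h := hw0 x
  exact sub_eq_zero.mp (norm_le_zero_iff.mp h)

/-! ### §3b The bridge split through the kill switch (typed-admissible, engine-less) -/

/-- **D0a (sector Liouville fails):** the negation of the route's kill switch stmt-1405 — SOME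
nontrivial `G`-equivariant Type-I bounded ancient mild solution exists (not necessarily DSS). Strictly
below X⁻ (`d0a_of_crux`); NOT known to refute the summit (no landed bridge from a mere ancient
solution to a blow-up: Albritton–Barker runs the other way). -/
def D0a_SectorLiouvilleFails : Prop := ¬ Theses.QuantisedSymmetry.PolyhedralTypeILiouville

/-- **D0b (DSS selection / closing lemma for the Leray similarity flow in the sector):** if the
sector carries a nontrivial Type-I ancient solution, it carries a PERIODIC (DSS) one. -/
def D0b_DssSelection : Prop := D0a_SectorLiouvilleFails → Crux

theorem crux_of_D0 : D0a_SectorLiouvilleFails → D0b_DssSelection → Crux := fun h₁ h₂ => h₂ h₁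

theorem d0a_of_crux : Crux → D0a_SectorLiouvilleFails := fun hX hL =>
  Theorems.quantisedSymmetry_liouvilleKillsProfile_proof hL hX

/-! ## §4 Transfer: the forward engine is a tree theorem; its bound does not run backward -/

/-- The solved sibling: FORWARD `λ`-DSS solutions exist for every factor and every scale-invariant
`L²_loc` datum (Chae–Wolf 2018 / Bradshaw–Tsai 2017, proved in the tree). -/
theorem forward_engine_in_tree : chaeWolf2018_dss_existence := chaeWolf2018_dss_existence_holds

/-! ## §5 Negation -/

/-- The route's kill switch (stmt-1405) refutes the crux (glue stmt-1408, landed). -/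
theorem not_crux_of_polyhedralLiouville :
    Theses.QuantisedSymmetry.PolyhedralTypeILiouville → ¬ Crux :=
  Theorems.quantisedSymmetry_liouvilleKillsProfile_proof

/-- The near-`λ = 1` regime is already closed on the Liouville side (Pineau–Vicol 2026 Thm 1.7,
proved in the tree): any X⁻ witness has `λ ≥ λ̄(C₀) > 1`. -/
theorem nearOne_liouville_in_tree : pineauVicol2026_rdss_liouville :=
  pineauVicol2026_rdss_liouville_holds

end Summit.NavierStokesRegularity.NavierStokesRegularity.Cruxes.PolyhedralDssProfileExists.S14g2

end
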